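/-
Copyright (c) 2026. All rights reserved.
Released under Apache 2.0 license as described in the file LICENSE.
-/
import Summits.HubbardSuperconductivity.HubbardLadder.Bounds.AdjacentRatioWindow
import HarnessLib

/-!
# The walk input from log-Lipschitz sector weights (bounds.tex §13, Lemma 13.5′)

HONEST FRAMING: ladder R1–R4 with certified numbers; no claim on H/H₀. These are bounds for
MODEL CLASSES (the typed repulsive/attractive Hubbard torus with a flux twist), no materials
claim. This part is MODEL-FREE real analysis, the orbit-sum-transfer twin of
`SectorRatioEnvelope` (#211.13): it converts LOG-LIPSCHITZ CONTINUITY of positive sector weights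
`w 0, …, w n`,

`(n - k) w k ≤ e^{b/(n-k)} (k+1) w (k+1)`,  `(k+1) w (k+1) ≤ e^{b/(k+1)} (n - k) w k`  (`k + 1 ≤ n`,
`b ≥ 0`) — the shape delivered for the Gibbs weight of ANY number-conserving Hermitian `K` with
`‖[K, c_o]‖, ‖[K, c†_o]‖ ≤ r` by the tree's
`Literature.MathematicalPhysics.QuantumLattice.sectorWeight_orbitSum_transfer` (with `b = β n r`,
ALL `β ≥ 0`, Ruelle 1969 §3.4) — into the two antitone envelopes of
`AdjacentRatioWindow.adjacent_ratio_window_sector` (#211.12):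

* `T⁻ k = e^{s} (n-k)/(k+1) · e^{-b/(n-k)}`, `T⁺ k = e^{s} (n-k)/(k+1) · e^{b/(k+1)}`
  (`transferAm`, `transferAp`), positive and antitone on `k + 1 ≤ n` — NO separation condition;
* `walk_input_of_transfer`: under the Chebyshev input of #211.12 (`Var(s) ≤ K²/4`,
  `|m(s) - N| ≤ K₀`, `K₀ + 2K + 2 ≤ K_w ≤ N`, `N + K_w ≤ n`) the conclusion is EXACTLY the pair
  `hG : 0 ≤ G`, `hadj` of `SectorTwistRatio.norm_ttSectorZ_twist_sub_le` (#211.8) with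
  `G = log C`, `C = transferWalkConstant n N K_w b s = T⁺(N - K_w) / T⁻(N + K_w - 1)`.

Size of the constant (stated, not hidden): `log C = b/(N-K_w+1) + b/(n-N-K_w+1) +
log((n-N+K_w)(N+K_w)/((N-K_w+1)(n-N-K_w+1)))`; with `b = β n r`, `n = 2L²`, `N = ρL²` the first two
terms are `≈ 2βr/ρ + 2βr/(2-ρ)` (volume-independent) and the walk factor `C^{2K_w}` with
`K_w ~ √n` is `e^{O(β r L)}` — to be beaten by the numerator's `e^{-δL}`, a condition on `β r`
versus `δ` (HIGH TEMPERATURE), never an assumption on `L`. No numerics, no `native_decide`; standard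
axioms only. References: D. Ruelle, Statistical Mechanics (1969) §3.4 [Ruelle1969]; programme notes
bounds.tex §13.
-/

noncomputable section

namespace Summit.HubbardSuperconductivity.HubbardLadder.Bounds

open Finset Real

variable {w : ℕ → ℝ} {n : ℕ}

/-! ### The two transfer envelopes -/

/-- The lower transfer envelope `T⁻ k = e^{s} (n - k)/(k + 1) · e^{-b/(n - k)}`.
[programme definition: bounds.tex §13, Lemma 13.5′] -/
def transferAm (n : ℕ) (b s : ℝ) (k : ℕ) : ℝ :=
  exp s * ((n : ℝ) - k) / ((k : ℝ) + 1) * exp (-(b / ((n : ℝ) - k)))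

/-- The upper transfer envelope `T⁺ k = e^{s} (n - k)/(k + 1) · e^{b/(k + 1)}`.
[programme definition: bounds.tex §13, Lemma 13.5′] -/
def transferAp (n : ℕ) (b s : ℝ) (k : ℕ) : ℝ :=
  exp s * ((n : ℝ) - k) / ((k : ℝ) + 1) * exp (b / ((k : ℝ) + 1))

/-- `T⁻ k > 0` for `k + 1 ≤ n`. [this file] -/
theorem transferAm_pos (b s : ℝ) {k : ℕ} (hk : k + 1 ≤ n) : 0 < transferAm n b s k := by
  unfold transferAm
  have hk' : ((k : ℕ) : ℝ) + 1 ≤ n := by exact_mod_cast hk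
  exact mul_pos (div_pos (mul_pos (exp_pos s) (by linarith)) (by positivity)) (exp_pos _)

/-- `T⁺ k > 0` for `k + 1 ≤ n`. [this file] -/
theorem transferAp_pos (b s : ℝ) {k : ℕ} (hk : k + 1 ≤ n) : 0 < transferAp n b s k := by
  unfold transferAp
  have hk' : ((k : ℕ) : ℝ) + 1 ≤ n := by exact_mod_cast hk
  exact mul_pos (div_pos (mul_pos (exp_pos s) (by linarith)) (by positivity)) (exp_pos _)

/-- The rational factor `(n - k)/(k + 1)` is antitone in `k` on `k + 1 ≤ n`. [this file] -/
theorem div_succ_antitone {i j : ℕ} (hij : i ≤ j) (hj : j + 1 ≤ n) :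
    ((n : ℝ) - j) / ((j : ℝ) + 1) ≤ ((n : ℝ) - i) / ((i : ℝ) + 1) := by
  have hj' : ((j : ℕ) : ℝ) + 1 ≤ n := by exact_mod_cast hj
  have hij' : ((i : ℕ) : ℝ) ≤ j := by exact_mod_cast hij
  rw [div_le_div_iff₀ (by positivity) (by positivity)]
  nlinarith

/-- `T⁻` is antitone on `k + 1 ≤ n` (`0 ≤ b`). [this file] -/
theorem transferAm_antitone {b : ℝ} (hb : 0 ≤ b) (s : ℝ) {i j : ℕ} (hij : i ≤ j) (hj : j + 1 ≤ n) :
    transferAm n b s j ≤ transferAm n b s i := by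
  unfold transferAm
  have hj' : ((j : ℕ) : ℝ) + 1 ≤ n := by exact_mod_cast hj
  have hij' : ((i : ℕ) : ℝ) ≤ j := by exact_mod_cast hij
  have h1 := div_succ_antitone (n := n) hij hj
  have h2 : exp (-(b / ((n : ℝ) - j))) ≤ exp (-(b / ((n : ℝ) - i))) := by
    rw [exp_le_exp, neg_le_neg_iff]
    exact div_le_div_of_nonneg_left hb (by linarith) (by linarith)
  rw [mul_div_assoc, mul_div_assoc, mul_assoc, mul_assoc]
  refine mul_le_mul_of_nonneg_left ?_ (exp_pos s).le
  exact mul_le_mul h1 h2 (exp_pos _).le (div_nonneg (by linarith) (by positivity))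

/-- `T⁺` is antitone on `k + 1 ≤ n` (`0 ≤ b`). [this file] -/
theorem transferAp_antitone {b : ℝ} (hb : 0 ≤ b) (s : ℝ) {i j : ℕ} (hij : i ≤ j) (hj : j + 1 ≤ n) :
    transferAp n b s j ≤ transferAp n b s i := by
  unfold transferAp
  have hj' : ((j : ℕ) : ℝ) + 1 ≤ n := by exact_mod_cast hj
  have hij' : ((i : ℕ) : ℝ) ≤ j := by exact_mod_cast hij
  have h1 := div_succ_antitone (n := n) hij hj
  have h2 : exp (b / ((j : ℝ) + 1)) ≤ exp (b / ((i : ℝ) + 1)) := by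
    rw [exp_le_exp]
    exact div_le_div_of_nonneg_left hb (by positivity) (by linarith)
  rw [mul_div_assoc, mul_div_assoc, mul_assoc, mul_assoc]
  refine mul_le_mul_of_nonneg_left ?_ (exp_pos s).le
  exact mul_le_mul h1 h2 (exp_pos _).le (div_nonneg (by linarith) (by positivity))

/-! ### The envelopes from log-Lipschitz continuity -/

/-- LOWER ENVELOPE: `(n - k) w k ≤ e^{b/(n-k)} (k + 1) w (k+1)` gives
`T⁻ k · e^{sk} w k ≤ e^{s(k+1)} w (k+1)`. [this file; bounds.tex Lemma 13.5′] -/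
theorem envelope_lo_of_transfer {b : ℝ} (s : ℝ)
    (htr : ∀ k : ℕ, k + 1 ≤ n →
      ((n : ℝ) - k) * w k ≤ exp (b / ((n : ℝ) - k)) * (((k : ℝ) + 1) * w (k + 1))) :
    ∀ k : ℕ, k + 1 ≤ n →
      transferAm n b s k * (exp (s * k) * w k) ≤ exp (s * ((k + 1 : ℕ) : ℝ)) * w (k + 1) := by
  intro k hk
  have h1 := htr k hk
  have hq : ((n : ℝ) - k) / ((k : ℝ) + 1) * exp (-(b / ((n : ℝ) - k))) * w k ≤ w (k + 1) := by
    rw [Real.exp_neg, show ((n : ℝ) - k) / ((k : ℝ) + 1) * (exp (b / ((n : ℝ) - k)))⁻¹ * w k =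
      ((n : ℝ) - k) * w k / (((k : ℝ) + 1) * exp (b / ((n : ℝ) - k))) by
        field_simp, div_le_iff₀ (by positivity)]
    calc ((n : ℝ) - k) * w k ≤ exp (b / ((n : ℝ) - k)) * (((k : ℝ) + 1) * w (k + 1)) := h1
      _ = w (k + 1) * (((k : ℝ) + 1) * exp (b / ((n : ℝ) - k))) := by ring
  have he : exp (s * ((k + 1 : ℕ) : ℝ)) = exp s * exp (s * k) := by
    rw [← Real.exp_add]; push_cast; ring_nf
  unfold transferAm
  rw [he]
  calc exp s * ((n : ℝ) - k) / ((k : ℝ) + 1) * exp (-(b / ((n : ℝ) - k))) * (exp (s * k) * w k)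
      = exp s * exp (s * k) *
          (((n : ℝ) - k) / ((k : ℝ) + 1) * exp (-(b / ((n : ℝ) - k))) * w k) := by ring
    _ ≤ exp s * exp (s * k) * w (k + 1) := mul_le_mul_of_nonneg_left hq (by positivity)

/-- UPPER ENVELOPE: `(k + 1) w (k+1) ≤ e^{b/(k+1)} (n - k) w k` gives
`e^{s(k+1)} w (k+1) ≤ T⁺ k · e^{sk} w k`. [this file; bounds.tex Lemma 13.5′] -/
theorem envelope_hi_of_transfer {b : ℝ} (s : ℝ)
    (htr : ∀ k : ℕ, k + 1 ≤ n →
      ((k : ℝ) + 1) * w (k + 1) ≤ exp (b / ((k : ℝ) + 1)) * (((n : ℝ) - k) * w k)) :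
    ∀ k : ℕ, k + 1 ≤ n →
      exp (s * ((k + 1 : ℕ) : ℝ)) * w (k + 1) ≤ transferAp n b s k * (exp (s * k) * w k) := by
  intro k hk
  have h2 := htr k hk
  have hk1 : (0 : ℝ) < (k : ℝ) + 1 := by positivity
  have hq : w (k + 1) ≤ ((n : ℝ) - k) / ((k : ℝ) + 1) * exp (b / ((k : ℝ) + 1)) * w k := by
    rw [show ((n : ℝ) - k) / ((k : ℝ) + 1) * exp (b / ((k : ℝ) + 1)) * w k =
      exp (b / ((k : ℝ) + 1)) * (((n : ℝ) - k) * w k) / ((k : ℝ) + 1) by ring, le_div_iff₀ hk1]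
    calc w (k + 1) * ((k : ℝ) + 1) = ((k : ℝ) + 1) * w (k + 1) := by ring
      _ ≤ exp (b / ((k : ℝ) + 1)) * (((n : ℝ) - k) * w k) := h2
  have he : exp (s * ((k + 1 : ℕ) : ℝ)) = exp s * exp (s * k) := by
    rw [← Real.exp_add]; push_cast; ring_nf
  unfold transferAp
  rw [he]
  calc exp s * exp (s * k) * w (k + 1)
      ≤ exp s * exp (s * k) * (((n : ℝ) - k) / ((k : ℝ) + 1) * exp (b / ((k : ℝ) + 1)) * w k) :=
        mul_le_mul_of_nonneg_left hq (by positivity)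
    _ = exp s * ((n : ℝ) - k) / ((k : ℝ) + 1) * exp (b / ((k : ℝ) + 1)) * (exp (s * k) * w k) := by
        ring

/-! ### The walk input from log-Lipschitz continuity -/

/-- The walk rate constant `C = T⁺ (N - K_w) / T⁻ (N + K_w - 1)` of the transfer envelopes.
[programme definition: bounds.tex §13, Lemma 13.5′] -/
def transferWalkConstant (n N Kw : ℕ) (b s : ℝ) : ℝ :=
  transferAp n b s (N - Kw) / transferAm n b s (N + Kw - 1)

/-- The transfer walk constant is positive (`N + K_w ≤ n`, `1 ≤ K_w`). [this file] -/
theorem transferWalkConstant_pos {N Kw : ℕ} (b s : ℝ) (hKw : 1 ≤ Kw) (hNn : N + Kw ≤ n) :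
    0 < transferWalkConstant n N Kw b s :=
  div_pos (transferAp_pos b s (by omega)) (transferAm_pos b s (by omega))

/-- THE WALK INPUT FROM LOG-LIPSCHITZ CONTINUITY (exactly the hypotheses `hG`, `hadj` of
`norm_ttSectorZ_twist_sub_le`, with `G = log C`, `C = transferWalkConstant n N K_w b s`). Assume
the two-sided log-Lipschitz bounds with constant `b ≥ 0` on `k + 1 ≤ n`, the Chebyshev input
`Var(s) ≤ K²/4`, `|m(s) - N| ≤ K₀`, `K₀ + 2K + 2 ≤ K_w ≤ N` and `N + K_w ≤ n`. Then `G ≥ 0` and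
for `N - K_w ≤ k`, `k + 1 ≤ min (N + K_w) n`: `e^{s(k+1)} w (k+1) ≤ e^{G} e^{sk} w k` and
`e^{sk} w k ≤ e^{G} e^{s(k+1)} w (k+1)`. Proof: `adjacent_ratio_window_sector` with the envelopes
clamped to `k + 1 ≤ n` (`T∓ (min k (n-1))`), where they are positive and antitone.
[folklore second-moment method; this file] -/
theorem walk_input_of_transfer (hw : ∀ k ≤ n, 0 < w k) (s : ℝ) {K K₀ b : ℝ} (hK : 0 < K)
    (hV : gcVar w n s ≤ K ^ 2 / 4) (hb : 0 ≤ b)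
    (htr : ∀ k : ℕ, k + 1 ≤ n →
      ((n : ℝ) - k) * w k ≤ exp (b / ((n : ℝ) - k)) * (((k : ℝ) + 1) * w (k + 1)) ∧
        ((k : ℝ) + 1) * w (k + 1) ≤ exp (b / ((k : ℝ) + 1)) * (((n : ℝ) - k) * w k))
    {N Kw : ℕ} (hm : |gcMean w n s - N| ≤ K₀) (hKw : K₀ + 2 * K + 2 ≤ Kw) (hKwN : Kw ≤ N)
    (hNn : N + Kw ≤ n) :
    0 ≤ Real.log (transferWalkConstant n N Kw b s) ∧
      ∀ k : ℕ, N - Kw ≤ k → k + 1 ≤ min (N + Kw) n →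
        Real.exp (s * (k + 1 : ℕ)) * w (k + 1) ≤
            Real.exp (Real.log (transferWalkConstant n N Kw b s)) * (Real.exp (s * k) * w k) ∧
          Real.exp (s * k) * w k ≤
            Real.exp (Real.log (transferWalkConstant n N Kw b s)) *
              (Real.exp (s * (k + 1 : ℕ)) * w (k + 1)) := by
  have hK₀ : 0 ≤ K₀ := (abs_nonneg _).trans hm
  have hKw2 : (2 : ℝ) < Kw := by linarith
  have hKw2' : 2 < Kw := by exact_mod_cast hKw2
  have hn1 : 1 ≤ n := by omega
  have hC : walkConstant (fun k => transferAm n b s (min k (n - 1)))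
      (fun k => transferAp n b s (min k (n - 1))) (N - Kw) (N + Kw - 1) =
      transferWalkConstant n N Kw b s := by
    unfold walkConstant transferWalkConstant
    beta_reduce
    rw [min_eq_left (show N - Kw ≤ n - 1 by omega), min_eq_left (show N + Kw - 1 ≤ n - 1 by omega)]
  rw [← hC]
  refine adjacent_ratio_window_sector hw s hK hV
    (Am := fun k => transferAm n b s (min k (n - 1)))
    (Ap := fun k => transferAp n b s (min k (n - 1)))
    (fun k => transferAm_pos b s (by omega)) (fun i j hij => ?_) (fun i j hij => ?_)
    (fun k hk => ?_) (fun k _ hk => ?_) hm hKw hKwN hNn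
  · exact transferAm_antitone hb s (show min i (n - 1) ≤ min j (n - 1) by omega) (by omega)
  · exact transferAp_antitone hb s (show min i (n - 1) ≤ min j (n - 1) by omega) (by omega)
  · simp only [min_eq_left (show k ≤ n - 1 by omega)]
    exact envelope_lo_of_transfer s (fun k hk => (htr k hk).1) k hk
  · simp only [min_eq_left (show k ≤ n - 1 by omega)]
    exact envelope_hi_of_transfer s (fun k hk => (htr k hk).2) k hk

end Summit.HubbardSuperconductivity.HubbardLadder.Bounds
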